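import Literature.NumberTheory.Automorphic.Paramodular.Paramodularity
import Literature.NumberTheory.DiophantineGeometry.AVGaloisModuleContinuityProofs
import Literature.NumberTheory.DiophantineGeometry.AVGaloisModuleTateRankOfCubeProofs
import Literature.NumberTheory.GaloisRepresentations.FiniteOrderTwistLanglandsTunnellInputs
import Literature.NumberTheory.FaltingsSerre.ParamodularBridge
import Literature.NumberTheory.LFunctions.WeilConjecturesFatouProofs
import HarnessLib

/-!
# Venture ResidMod — frames of `V_ℓ(A)` for an abelian surface, and two consequences of a good Euler
# factor: the framed dual's Frobenius polynomial (positive form) and trivial inertia (bridge B1)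

HONEST FRAMING. Theorems only (no fact, no definition, no claim about any surface); plumbing
for the cell `pub-residmod` (PLAN R11, bridges B1/B3). For an abelian surface `A/ℚ` (`A.dim = 2`) the
tree proves `dim V_ℓ(A) = 4` and finiteness, so `V_ℓ(A)` has a `ℚ_ℓ`-basis indexed by `Fin 4` and the
matrix form `[·]_b` of the continuous Galois action is a `FramedGaloisRep` (`ContinuousRep.frame`);
this removes the "choose a frame" binders (`hframe`) from the cell's certificate theorems. Then, from
the Euler-factor predicate the engines certify, `A.HasGoodEulerFactorAt p L` ([BPPTVY (4.1.5)]):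
* `hasFrobCharpolyAt_dualFrame_of_hasGoodEulerFactorAt` — for `ℓ ≠ p` the framed DUAL
  `r(g) = [g⁻¹]_bᵀ ⊗ ℚ̄_ℓ` (BCGP's `ρ_{A,ℓ}` on `H¹`) has Frobenius polynomial `C (lc L)⁻¹ · L(X)` at
  `v ∣ p` (positive `HasFrobCharpolyAt` form of `EulerFactorDualFrame.dualFrame_of_hasGoodEulerFactorAt`);
* `rationalTateRep_restrict_eq_one_of_hasGoodEulerFactorAt` and
  `semistableClause_of_hasGoodEulerFactorAt_two` — BRIDGE B1: a good Euler factor at `p` makes every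
  `V_ℓ(A)`, `ℓ ≠ p`, unramified at `p` in the LOCAL form used by the tree's BCGP facts: every `τ` in the
  inertia group of `ℚ_p = v.adicCompletion ℚ` acts trivially, `ρ_ℓ(res τ) = 1`, hence in particular
  `(ρ_ℓ(res τ) − 1)² = 0` — hypothesis (3a) "good ordinary OR SEMISTABLE reduction at `2`" of BCGP 2025
  Thm. 8.3.2 in its Galois form (the clause `hss` of `Mod2A5bCertificate.modular_of_mod2Certificate`),
  in the GOOD-reduction case. Local–global compatibility of inertia is the tree's
  `FramedGaloisRep.toLocal_eq_one_of_isUnramifiedAt` (Neukirch II (9.6)).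

References: [BrumerEtAl2019] ANT 13 (2019) (4.1.5); [BoxerCalegariGeePilloni2025] arXiv:2502.20645
Thm. 8.3.2 (3), §1.8; [SerreTate1968] §1 (Néron–Ogg–Shafarevich: good reduction ⇒ unramified);
[NeukirchANT1999] II (9.6).
-/

noncomputable section

namespace Summit.Ventures.ResidMod

open Polynomial Matrix Field IsDedekindDomain
open scoped NumberField TensorProduct
open Literature.NumberTheory.GaloisRepresentations Literature.NumberTheory.Automorphic.Paramodular
open Literature.NumberTheory.FaltingsSerre
open Literature.AlgebraicGeometry.Motives (AbelianVariety)

variable {A : AbelianVariety ℚ}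

/-! ## A. Frames of `V_ℓ(A)` -/

/-- `V_ℓ(A)` of an abelian surface `A/ℚ` is a finite `4`-dimensional `ℚ_ℓ`-space (tree theorems
`module_finite_tateModule_of_cast_ne_zero`, `finrank_rationalTateModule_eq_two_mul_dim`): it has a
basis indexed by `Fin 4`. [cite: SerreTate1968, §1] -/
theorem nonempty_basis_rationalTateModule (hA : A.dim = 2) (ℓ : ℕ) [Fact ℓ.Prime] :
    Nonempty (Module.Basis (Fin 4) ℚ_[ℓ] (A.rationalTateModule ℓ)) := by
  have hℓ : ((ℓ : ℕ) : ℚ) ≠ 0 := Nat.cast_ne_zero.2 (Fact.out : ℓ.Prime).ne_zero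
  haveI := Literature.AlgebraicGeometry.Motives.AbelianVariety.module_finite_tateModule_of_cast_ne_zero A ℓ hℓ
  haveI : Module.Finite ℚ_[ℓ] (A.rationalTateModule ℓ) := by
    change Module.Finite ℚ_[ℓ] (ℚ_[ℓ] ⊗[ℤ_[ℓ]] A.tateModule ℓ)
    infer_instance
  have hrk : Module.finrank ℚ_[ℓ] (A.rationalTateModule ℓ) = 4 := by
    rw [A.finrank_rationalTateModule_eq_two_mul_dim ℓ hℓ, hA]
  exact ⟨Module.finBasisOfFinrankEq ℚ_[ℓ] (A.rationalTateModule ℓ) hrk⟩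

/-- The matrix form `[·]_b` of `V_ℓ(A)` in a basis `b` (`ContinuousRep.frame` of the tree's continuous
Galois representation `rationalTateGaloisRep`, continuity by `continuous_rationalTateRep_holds`) IS a
frame of the Tate representation in the sense of `IsFrameOfTateRep`. [cite: BrumerEtAl2019, (4.1.3)] -/
theorem isFrameOfTateRep_frame (ℓ : ℕ) [Fact ℓ.Prime] (hℓ : ((ℓ : ℕ) : ℚ) ≠ 0)
    (b : Module.Basis (Fin 4) ℚ_[ℓ] (A.rationalTateModule ℓ)) :
    A.IsFrameOfTateRep ℓ b ((A.rationalTateGaloisRep ℓ (A.continuous_rationalTateRep_holds ℓ hℓ)).frame b) :=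
  fun g => by rw [ContinuousRep.coe_frame_apply]; rfl

/-- Every abelian surface has SOME matrix form of `V_ℓ(A)` (a basis and its frame) — the binder
`hframe` of the cell's Euler-factor theorems is always satisfiable. [cite: SerreTate1968, §1] -/
theorem exists_isFrameOfTateRep (hA : A.dim = 2) (ℓ : ℕ) [Fact ℓ.Prime] :
    ∃ (b : Module.Basis (Fin 4) ℚ_[ℓ] (A.rationalTateModule ℓ)) (r : FramedGaloisRep ℚ ℚ_[ℓ] 4),
      A.IsFrameOfTateRep ℓ b r := by
  obtain ⟨b⟩ := nonempty_basis_rationalTateModule hA ℓ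
  exact ⟨b, _, isFrameOfTateRep_frame ℓ (Nat.cast_ne_zero.2 (Fact.out : ℓ.Prime).ne_zero) b⟩

/-! ## B. The framed dual's Frobenius polynomial (positive form) -/

/-- **`det(X − r(Frob_v)) = C (lc L)⁻¹ · L(X)` for the framed dual `r(g) = [g⁻¹]_bᵀ` of `V_ℓ(A)`**
at a good prime `p ≠ ℓ` with Euler factor `L = L_p(A,T)` (`L(0) ≠ 0`), as a `HasFrobCharpolyAt`
statement: the direct frame has Frobenius polynomial `X⁴L(1/X)` (definition of `HasGoodEulerFactorAt`)
and `det(X − M⁻¹) = det(M)⁻¹ · reverse det(X − M)` (`Matrix.charpoly_inv`).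
[cite: BrumerEtAl2019, (4.1.5) p. 1164] [cite: BoxerCalegariGeePilloni2025, §1.8 (ρ_{A,p} on H¹)] -/
theorem hasFrobCharpolyAt_dualFrame_of_hasGoodEulerFactorAt {p : ℕ} {L : ℚ[X]}
    (hL : A.HasGoodEulerFactorAt p L) (hL0 : L.coeff 0 ≠ 0)
    {ℓ : ℕ} [Fact ℓ.Prime] (hℓ : ℓ ≠ p) (b : Module.Basis (Fin 4) ℚ_[ℓ] (A.rationalTateModule ℓ))
    (r : FramedGaloisRep ℚ (PadicAlgCl ℓ) 4)
    (hr : ∀ g : absoluteGaloisGroup ℚ,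
      (r g).val =
        ((LinearMap.toMatrix b b (A.rationalTateRep ℓ g⁻¹)).map (algebraMap ℚ_[ℓ] (PadicAlgCl ℓ))).transpose)
    {v : HeightOneSpectrum (𝓞 ℚ)} (hv : ((p : ℕ) : 𝓞 ℚ) ∈ v.asIdeal) :
    r.HasFrobCharpolyAt v
      (C ((algebraMap ℚ (PadicAlgCl ℓ) L.leadingCoeff)⁻¹) * L.map (algebraMap ℚ (PadicAlgCl ℓ))) := by
  intro 𝔓 h𝔓 σ hσ
  have hℓ0 : ((ℓ : ℕ) : ℚ) ≠ 0 := Nat.cast_ne_zero.2 (Fact.out : ℓ.Prime).ne_zero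
  set r₀ : FramedGaloisRep ℚ ℚ_[ℓ] 4 :=
    (A.rationalTateGaloisRep ℓ (A.continuous_rationalTateRep_holds ℓ hℓ0)).frame b with hr₀def
  have hfr : A.IsFrameOfTateRep ℓ b r₀ := isFrameOfTateRep_frame ℓ hℓ0 b
  have hR : FramedRep.charpoly r₀ σ = L.reverse.map (algebraMap ℚ ℚ_[ℓ]) :=
    (hL ℓ hℓ b r₀ hfr v hv).2 𝔓 h𝔓 σ hσ
  rw [FramedRep.charpoly] at hR ⊢
  set M : Matrix (Fin 4) (Fin 4) ℚ_[ℓ] := (r₀ σ).val with hMdef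
  have hMunit : IsUnit M := ⟨r₀ σ, rfl⟩
  have hdet : M.det = algebraMap ℚ ℚ_[ℓ] L.leadingCoeff := by
    rw [Matrix.det_eq_sign_charpoly_coeff, hR, coeff_map, coeff_zero_reverse, Fintype.card_fin]
    norm_num
  have hinv : (M⁻¹).charpoly = C (algebraMap ℚ ℚ_[ℓ] L.leadingCoeff)⁻¹ * L.map (algebraMap ℚ ℚ_[ℓ]) := by
    rw [Matrix.charpoly_inv M hMunit, ← Matrix.reverse_charpoly, hR, Fintype.card_fin,
      reverse_map_of_injective _ (algebraMap ℚ ℚ_[ℓ]).injective,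
      Literature.NumberTheory.LFunctions.WeilFatou.reverse_reverse_of_coeff_zero_ne_zero hL0, hdet,
      Ring.inverse_eq_inv']
    norm_num
  have hval : (r σ).val = ((M⁻¹).map (algebraMap ℚ_[ℓ] (PadicAlgCl ℓ)))ᵀ := by
    rw [hr σ, ← hfr σ⁻¹, map_inv, Matrix.coe_units_inv]
  rw [hval, Matrix.charpoly_transpose, Matrix.charpoly_map, hinv, Polynomial.map_mul, map_C, map_inv₀,
    Polynomial.map_map, ← IsScalarTower.algebraMap_eq, ← IsScalarTower.algebraMap_apply]

/-! ## C. Bridge B1: a good Euler factor at `p` ⟹ local inertia at `p` acts trivially on `V_ℓ(A)` -/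

/-- **Good Euler factor at `p` ⟹ `ρ_{A,ℓ}(res τ) = 1` for every `τ` in the inertia group of `ℚ_p`**
(`ℓ ≠ p`): `HasGoodEulerFactorAt` makes the frame `[·]_b` unramified at `v ∣ p` (all global inertia
groups over `v` act trivially), and local–global compatibility of inertia
(`FramedGaloisRep.toLocal_eq_one_of_isUnramifiedAt`, Neukirch II (9.6)) transports this to the local
inertia group `absInertia (v.adicCompletion ℚ)` through `absGaloisRestrict`.
[cite: SerreTate1968, §1 Thm. 1 (Néron–Ogg–Shafarevich)] [cite: NeukirchANT1999, Ch. II §9 Prop. (9.6)] -/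
theorem rationalTateRep_restrict_eq_one_of_hasGoodEulerFactorAt (hA : A.dim = 2) {p : ℕ} {L : ℚ[X]}
    (hL : A.HasGoodEulerFactorAt p L) {ℓ : ℕ} [Fact ℓ.Prime] (hℓ : ℓ ≠ p)
    {v : HeightOneSpectrum (𝓞 ℚ)} (hv : ((p : ℕ) : 𝓞 ℚ) ∈ v.asIdeal)
    {τ : absoluteGaloisGroup (v.adicCompletion ℚ)} (hτ : τ ∈ absInertia (v.adicCompletion ℚ)) :
    A.rationalTateRep ℓ (absGaloisRestrict ℚ (v.adicCompletion ℚ) τ) = 1 := by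
  obtain ⟨b, r₀, hfr⟩ := exists_isFrameOfTateRep hA ℓ
  have hunr : r₀.IsUnramifiedAt v := (hL ℓ hℓ b r₀ hfr v hv).1
  have h1 := FramedGaloisRep.toLocal_eq_one_of_isUnramifiedAt v r₀ hunr hτ
  rw [FramedGaloisRep.toLocal_apply] at h1
  have h2 := congrArg (fun u : GL (Fin 4) ℚ_[ℓ] => (u : Matrix (Fin 4) (Fin 4) ℚ_[ℓ])) h1
  simp only [Units.val_one] at h2
  rw [hfr] at h2
  exact (LinearMap.toMatrix b b).injective (by rw [h2, LinearMap.toMatrix_one])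

/-- **Bridge B1 (GOOD reduction at `2`): the semistable clause `hss` of Thm. 8.3.2 (3) from the Euler
factor at `2`.**  If `A` has a good Euler factor at `2` then for every prime `ℓ ≠ 2`, every `v ∣ 2` and
every `τ` in the inertia group of `ℚ₂`, `(ρ_{A,ℓ}(res τ) − 1)² = 0` (indeed `ρ_{A,ℓ}(res τ) = 1`) —
VERBATIM the clause of `bcgp_residuallyA5b_modular_abelianSurface` / `modular_of_mod2Certificate`.
[cite: BoxerCalegariGeePilloni2025, Thm. 8.3.2 (3)] [cite: SerreTate1968, §1 Thm. 1] -/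
theorem semistableClause_of_hasGoodEulerFactorAt_two (hA : A.dim = 2) {L : ℚ[X]}
    (hL : A.HasGoodEulerFactorAt 2 L) :
    ∀ (ℓ : ℕ) [Fact ℓ.Prime], ℓ ≠ 2 →
      ∀ v : HeightOneSpectrum (𝓞 ℚ), ((2 : ℕ) : 𝓞 ℚ) ∈ v.asIdeal →
        ∀ τ ∈ absInertia (v.adicCompletion ℚ),
          (A.rationalTateRep ℓ (absGaloisRestrict ℚ (v.adicCompletion ℚ) τ) - 1) ^ 2 = 0 := by
  intro ℓ _ hℓ v hv τ hτ
  rw [rationalTateRep_restrict_eq_one_of_hasGoodEulerFactorAt hA hL hℓ hv hτ, sub_self, sq, mul_zero]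

end Summit.Ventures.ResidMod

end
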